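import Summits.ResolutionOfSingularities.ResolutionOfSingularities.Theorems.AffineToGlobal.Negative.BlowupChartEmbedding

/-!
# `AffineToGlobal` — negative lemmas IV-b: the reduced singular point is NOT a one-shot centre
# (`y² = x⁵`: one blowing up of the curve `K[X², X⁵]` at its singular point stays singular)

Support (negative-side) lemmas for crux `stmt-ResolutionOfSingularities-15961`
(`Summit.ResolutionOfSingularities.ResolutionOfSingularities.Theses.SectionAscent.AffineToGlobal`),
filed by the crux disprover (cdisprove, gen 2, 2026-08-17). Negative lemmas II
(`CentreNotUnique.lean`) showed that the hypothesis `OneShot` never pins its centre. There is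
exactly ONE canonical, globally defined candidate a gluing proof of `AffineToGlobal` could try
instead of the non-canonical chartwise centres: the REDUCED ideal sheaf of the singular locus.
This file certifies the classical reason that candidate fails: for the plane curve `y² = x⁵`,
i.e. the monomial algebra `A = K[X², X⁵] ⊆ K[X]` (an integral affine curve of finite type over
any field `K`, singular at the origin `𝔪 = (X², X⁵)`), the blowing up `Bl_𝔪(Spec A)` along the
reduced singular point is NOT regular — its `X²`-chart is `A[X⁵/X²] = K[X², X³]`, the cuspidal
cubic (negative lemmas IV-a, `BlowupChartEmbedding.lean`). Since affine curves DO have one-shot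
centres (`OneShot p 2`, landed: `OneShotCurves.stub_oneShotCurves`, the conductor), the natural
strengthening "the one-shot centre may be taken to be the reduced ideal of (a point of) the
singular locus" is false in every characteristic, already for curves
(`not_reducedPoint_oneShotCentre`).

* `mem_span_iff_coeff_zero_eq_zero` — the origin of `K[X², X⁵]` is the ideal `(X², X⁵)` = the
  elements with vanishing constant term (every element is a constant plus a member of the span).
* `exists_not_isRegularLocalRing_chart` — the `x₂`-chart ring of `Bl_𝔭(Spec A)` (generic `A` as
  in IV-a) is a domain which is not regular at its origin.
* `not_isRegular_affineBlowup_of_coeff` — **hence `Bl_𝔭(Spec A)` is not regular** (charts are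
  open subschemes, `Proj.awayι`).
* `exists_point_blowup_not_regular` — **the witness assembled: the origin of `K[X², X⁵]` is a
  closed point (`IsMaximal`), non-regular, and `Bl_origin(Spec K[X², X⁵])` is NOT regular**, for
  every field `K`; `finiteType_cusp25`, `ringKrullDim_cusp25_lt_two`, and
  `exists_oneShotCentre_cusp25` (the same curve DOES have a one-shot centre, by the landed
  `OneShot p 2`).
* `not_reducedPoint_oneShotCentre` — **refuted strengthening, every prime `p`**: it is false that
  for all integral affine curves of finite type over fields of characteristic `p` the blowing up
  of a singular closed point (with its reduced structure) is regular.

No definition is declared; no declaration concludes a route decl positively.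

## Sources
* J. Kollár, *Lectures on Resolution of Singularities* (2007), §1.4 (blowing up curve points;
  `y² = x⁵` needs two blow-ups).
* U. Görtz, T. Wedhorn, *Algebraic Geometry I*, Prop. 13.92 (charts of the blowing up), as proved
  in the tree; Stacks 0804.
* H. Matsumura, *Commutative Ring Theory*, Thm. 19.4 (regular ⇒ normal), as proved in the tree.
-/

noncomputable section

set_option linter.dupNamespace false -- mandated namespace of this single-conjunct summit

open CategoryTheory AlgebraicGeometry Polynomial HomogeneousLocalization
open Literature.AlgebraicGeometry.Resolution
open Summit.ResolutionOfSingularities.ResolutionOfSingularities.Theses.SectionAscent (AffineToGlobal)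

namespace Summit.ResolutionOfSingularities.ResolutionOfSingularities.Theorems.AffineToGlobal.Negative

section PointBlowup

variable (K : Type) [Field K]

/-- **The origin of `K[X², X⁵]` is the ideal `(X², X⁵)`**: an element of the monomial algebra
has vanishing constant term iff it lies in the span of `X²` and `X⁵` (every element is a
constant plus an element of that span). [folklore] -/
theorem mem_span_iff_coeff_zero_eq_zero
    (a : ↥(Algebra.adjoin K ({X ^ 2, X ^ 5} : Set K[X]))) :
    a ∈ Ideal.span ({⟨X ^ 2, Algebra.subset_adjoin (by simp)⟩, ⟨X ^ 5, Algebra.subset_adjoin (by simp)⟩} :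
      Set ↥(Algebra.adjoin K ({X ^ 2, X ^ 5} : Set K[X]))) ↔ (a : K[X]).coeff 0 = 0 := by
  constructor
  · intro ha
    obtain ⟨b, c, rfl⟩ := Ideal.mem_span_pair.mp ha
    simp [Subalgebra.coe_add, Subalgebra.coe_mul]
  · intro h0
    -- every element of the algebra is a constant plus an element of the span
    have key : ∀ (f : K[X]) (hf : f ∈ Algebra.adjoin K ({X ^ 2, X ^ 5} : Set K[X])), ∃ c : K,
        (⟨f, hf⟩ : ↥(Algebra.adjoin K ({X ^ 2, X ^ 5} : Set K[X]))) -
            algebraMap K (↥(Algebra.adjoin K ({X ^ 2, X ^ 5} : Set K[X]))) c ∈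
          Ideal.span ({⟨X ^ 2, Algebra.subset_adjoin (by simp)⟩,
            ⟨X ^ 5, Algebra.subset_adjoin (by simp)⟩} :
            Set ↥(Algebra.adjoin K ({X ^ 2, X ^ 5} : Set K[X]))) := by
      intro f hf
      induction hf using Algebra.adjoin_induction with
      | mem x hx =>
        refine ⟨0, ?_⟩
        rw [map_zero, sub_zero]
        simp only [Set.mem_insert_iff, Set.mem_singleton_iff] at hx
        rcases hx with rfl | rfl
        · exact Ideal.subset_span (Set.mem_insert _ _)
        · exact Ideal.subset_span (Set.mem_insert_of_mem _ rfl)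
      | algebraMap c =>
        refine ⟨c, ?_⟩
        have : (⟨algebraMap K K[X] c, Subalgebra.algebraMap_mem _ c⟩ :
            ↥(Algebra.adjoin K ({X ^ 2, X ^ 5} : Set K[X]))) = algebraMap K _ c :=
          Subtype.ext rfl
        rw [this, sub_self]
        exact zero_mem _
      | add x y hx hy ihx ihy =>
        obtain ⟨c, hc⟩ := ihx
        obtain ⟨d, hd⟩ := ihy
        refine ⟨c + d, ?_⟩
        have : (⟨x + y, add_mem hx hy⟩ : ↥(Algebra.adjoin K ({X ^ 2, X ^ 5} : Set K[X]))) -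
              algebraMap K _ (c + d) =
            ((⟨x, hx⟩ : ↥(Algebra.adjoin K ({X ^ 2, X ^ 5} : Set K[X]))) - algebraMap K _ c) +
              ((⟨y, hy⟩ : ↥(Algebra.adjoin K ({X ^ 2, X ^ 5} : Set K[X]))) - algebraMap K _ d) := by
          rw [map_add]
          exact Subtype.ext (by
            simp only [Subalgebra.coe_add, AddSubgroupClass.coe_sub]; ring)
        rw [this]
        exact add_mem hc hd
      | mul x y hx hy ihx ihy =>
        obtain ⟨c, hc⟩ := ihx
        obtain ⟨d, hd⟩ := ihy
        refine ⟨c * d, ?_⟩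
        have : (⟨x * y, mul_mem hx hy⟩ : ↥(Algebra.adjoin K ({X ^ 2, X ^ 5} : Set K[X]))) -
              algebraMap K _ (c * d) =
            ((⟨x, hx⟩ : ↥(Algebra.adjoin K ({X ^ 2, X ^ 5} : Set K[X]))) - algebraMap K _ c) *
                ⟨y, hy⟩ +
              algebraMap K _ c *
                ((⟨y, hy⟩ : ↥(Algebra.adjoin K ({X ^ 2, X ^ 5} : Set K[X]))) - algebraMap K _ d) := by
          rw [map_mul]
          exact Subtype.ext (by
            simp only [Subalgebra.coe_add, Subalgebra.coe_mul, AddSubgroupClass.coe_sub]; ring)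
        rw [this]
        exact add_mem (Ideal.mul_mem_right _ _ hc) (Ideal.mul_mem_left _ _ hd)
    obtain ⟨c, hc⟩ := key a.1 a.2
    -- the constant is `a(0) = 0`
    obtain ⟨b, d, hbd⟩ := Ideal.mem_span_pair.mp hc
    have h1 := congrArg (fun z : ↥(Algebra.adjoin K ({X ^ 2, X ^ 5} : Set K[X])) =>
      (z : K[X]).coeff 0) hbd
    have ha0 : ((⟨a.1, a.2⟩ : ↥(Algebra.adjoin K ({X ^ 2, X ^ 5} : Set K[X]))) : K[X]).coeff 0 = 0 :=
      h0
    simp only [Subalgebra.coe_add, Subalgebra.coe_mul, AddSubgroupClass.coe_sub,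
      Subalgebra.coe_algebraMap, Polynomial.algebraMap_apply, Polynomial.coeff_sub,
      Polynomial.coeff_C_zero, ha0] at h1
    simp at h1
    have hc0 : c = 0 := h1
    rw [hc0, map_zero, sub_zero] at hc
    exact hc

/-- **The chart ring is not a regular ring**: it is a domain (it embeds in `K[X]`) which is not
regular at its origin (negative lemmas II, `not_isRegularLocalRing_origin_of_coeff_one_eq_zero`).
[cite: Matsumura1987, Thm. 19.4] -/
theorem exists_not_isRegularLocalRing_chart {A : Type} [CommRing A] [IsDomain A]
    (ι : A →+* K[X]) (hι : Function.Injective ι)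
    (hA : ∀ a : A, (ι a).coeff 1 = 0 ∧ (ι a).coeff 3 = 0)
    (x₂ x₅ : A) (hx₂ : ι x₂ = X ^ 2) (hx₅ : ι x₅ = X ^ 5)
    (𝔭 : Ideal A) (hgen : ∀ m ∈ 𝔭, ∃ b c : A, b * x₂ + c * x₅ = m) (hx₂𝔭 : x₂ ∈ 𝔭)
    (hx₅𝔭 : x₅ ∈ 𝔭) :
    ∃ 𝔮 : PrimeSpectrum (HomogeneousLocalization.Away (reesGrading 𝔭) (reesT x₂ hx₂𝔭)),
      ¬ IsRegularLocalRing (Localization.AtPrime 𝔮.asIdeal) := by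
  obtain ⟨ι₀, hinj, hA1, x₂', x₃', h2, h3⟩ :=
    exists_chart_ringHom K ι hι hA x₂ x₅ hx₂ hx₅ 𝔭 hgen hx₂𝔭 hx₅𝔭
  haveI : IsDomain (HomogeneousLocalization.Away (reesGrading 𝔭) (reesT x₂ hx₂𝔭)) :=
    hinj.isDomain ι₀
  obtain ⟨𝔮, h𝔮⟩ := exists_origin K ι₀
  exact ⟨𝔮, not_isRegularLocalRing_origin_of_coeff_one_eq_zero K ι₀ hinj hA1 x₂' x₃' h2 h3 𝔮 h𝔮⟩

/-- **The blowing up of such an `A` along the origin `𝔭 = (x₂, x₅)` is not regular**: the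
`x₂`-chart `Spec C → Bl_𝔭(Spec A)` is an open immersion (`Proj.awayι`), so regularity of the
blowing up would make every local ring of `C` regular. [cite: GortzWedhorn2020, Prop. 13.92] -/
theorem not_isRegular_affineBlowup_of_coeff {A : Type} [CommRing A] [IsDomain A]
    (ι : A →+* K[X]) (hι : Function.Injective ι)
    (hA : ∀ a : A, (ι a).coeff 1 = 0 ∧ (ι a).coeff 3 = 0)
    (x₂ x₅ : A) (hx₂ : ι x₂ = X ^ 2) (hx₅ : ι x₅ = X ^ 5)
    (𝔭 : Ideal A) (h𝔭 : ∀ a : A, a ∈ 𝔭 ↔ (ι a).coeff 0 = 0)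
    (hgen : ∀ m ∈ 𝔭, ∃ b c : A, b * x₂ + c * x₅ = m) :
    ¬ Scheme.IsRegular (affineBlowup 𝔭) := by
  intro hreg
  have hx₂𝔭 : x₂ ∈ 𝔭 := (h𝔭 _).mpr (by simp [hx₂])
  have hx₅𝔭 : x₅ ∈ 𝔭 := (h𝔭 _).mpr (by simp [hx₅])
  obtain ⟨𝔮, hbad⟩ := exists_not_isRegularLocalRing_chart K ι hι hA x₂ x₅ hx₂ hx₅ 𝔭 hgen hx₂𝔭 hx₅𝔭
  apply hbad
  haveI := hreg (Proj.awayι (reesGrading 𝔭) (reesT x₂ hx₂𝔭) (reesT_mem x₂ hx₂𝔭) Nat.one_pos 𝔮)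
  haveI : IsRegularLocalRing
      ((Spec (.of (HomogeneousLocalization.Away (reesGrading 𝔭) (reesT x₂ hx₂𝔭)))).presheaf.stalk 𝔮) :=
    IsRegularLocalRing.of_ringEquiv
      (asIso ((Proj.awayι (reesGrading 𝔭) (reesT x₂ hx₂𝔭) (reesT_mem x₂ hx₂𝔭)
        Nat.one_pos).stalkMap 𝔮)).commRingCatIsoToRingEquiv
  exact IsRegularLocalRing.of_ringEquiv
    (Spec.stalkIso (.of (HomogeneousLocalization.Away (reesGrading 𝔭) (reesT x₂ hx₂𝔭))) 𝔮).commRingCatIsoToRingEquiv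

/-! ## The witness `K[X², X⁵]` -/

/-- **The witness, assembled**: the origin of `K[X², X⁵]` is a closed point with non-regular
local ring whose blowing up is not regular. [folklore] -/
theorem exists_point_blowup_not_regular :
    ∃ 𝔭 : PrimeSpectrum ↥(Algebra.adjoin K ({X ^ 2, X ^ 5} : Set K[X])),
      𝔭.asIdeal.IsMaximal ∧ ¬ IsRegularLocalRing (Localization.AtPrime 𝔭.asIdeal) ∧
      ¬ Scheme.IsRegular (affineBlowup 𝔭.asIdeal) := by
  obtain ⟨𝔭, h𝔭⟩ := exists_origin K (Algebra.adjoin K ({X ^ 2, X ^ 5} : Set K[X])).val.toRingHom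
  have h𝔭' : ∀ a : ↥(Algebra.adjoin K ({X ^ 2, X ^ 5} : Set K[X])),
      a ∈ 𝔭.asIdeal ↔ (a : K[X]).coeff 0 = 0 := h𝔭
  have hgen : ∀ m ∈ 𝔭.asIdeal, ∃ b c : ↥(Algebra.adjoin K ({X ^ 2, X ^ 5} : Set K[X])),
      b * ⟨X ^ 2, Algebra.subset_adjoin (by simp)⟩ + c * ⟨X ^ 5, Algebra.subset_adjoin (by simp)⟩ = m :=
    fun m hm => Ideal.mem_span_pair.mp ((mem_span_iff_coeff_zero_eq_zero K m).mpr ((h𝔭' m).mp hm))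
  refine ⟨𝔭, ?_, ?_, not_isRegular_affineBlowup_of_coeff K
      (Algebra.adjoin K ({X ^ 2, X ^ 5} : Set K[X])).val.toRingHom Subtype.val_injective
      (fun a => coeff_one_three_eq_zero_of_mem K a.2) _ _ rfl rfl 𝔭.asIdeal h𝔭' hgen⟩
  · -- the residue ring is the field `K`
    apply Ideal.Quotient.maximal_of_isField
    refine ⟨⟨0, 1, ?_⟩, mul_comm, ?_⟩
    · intro h01
      have h1 : (1 : ↥(Algebra.adjoin K ({X ^ 2, X ^ 5} : Set K[X]))) ∈ 𝔭.asIdeal :=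
        Ideal.Quotient.eq_zero_iff_mem.mp h01.symm
      exact 𝔭.isPrime.ne_top ((Ideal.eq_top_iff_one _).mpr h1)
    · intro q hq
      obtain ⟨a, rfl⟩ := Ideal.Quotient.mk_surjective q
      have ha : a ∉ 𝔭.asIdeal := fun h => hq (Ideal.Quotient.eq_zero_iff_mem.mpr h)
      have ha0 : (a : K[X]).coeff 0 ≠ 0 := fun h => ha ((h𝔭' a).mpr h)
      refine ⟨Ideal.Quotient.mk _ (algebraMap K _ ((a : K[X]).coeff 0)⁻¹), ?_⟩
      rw [← map_mul, ← (Ideal.Quotient.mk 𝔭.asIdeal).map_one, Ideal.Quotient.eq, h𝔭']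
      simp [Subalgebra.coe_algebraMap, ha0]
  · exact not_isRegularLocalRing_origin_of_coeff_one_eq_zero' K
      (Algebra.adjoin K ({X ^ 2, X ^ 5} : Set K[X])).val.toRingHom Subtype.val_injective
      (fun a => (coeff_one_three_eq_zero_of_mem K a.2).1)
      ⟨X ^ 2, Algebra.subset_adjoin (by simp)⟩ ⟨X ^ 5, Algebra.subset_adjoin (by simp)⟩ 1
      rfl rfl 𝔭 h𝔭'

/-- The curve `K[X², X⁵]` is of finite type over `K`. [folklore] -/
theorem finiteType_cusp25 :
    Algebra.FiniteType K ↥(Algebra.adjoin K ({X ^ 2, X ^ 5} : Set K[X])) := by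
  rw [← Subalgebra.fg_iff_finiteType, Subalgebra.fg_def]
  exact ⟨{X ^ 2, X ^ 5}, Set.toFinite _, rfl⟩

/-- The curve `K[X², X⁵]` has Krull dimension `< 2`. [cite: Matsumura1987, Thm. 9.4] -/
theorem ringKrullDim_cusp25_lt_two :
    ringKrullDim ↥(Algebra.adjoin K ({X ^ 2, X ^ 5} : Set K[X])) < ((2 : ℕ) : WithBot ℕ∞) := by
  rw [ringKrullDim_eq_one_of_X_sq_mem K _ (Algebra.subset_adjoin (by simp))]
  decide

/-- **… although the same curve DOES have a one-shot centre** (the landed curve case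
`OneShot p 2`: its conductor), so what fails is the CHOICE of the reduced point as centre, not
the existence of a centre. [folklore] -/
theorem exists_oneShotCentre_cusp25 (p : ℕ) (hp : p.Prime) [CharP K p] :
    ∃ I : Ideal ↥(Algebra.adjoin K ({X ^ 2, X ^ 5} : Set K[X])), I ≠ ⊥ ∧
      Scheme.IsRegular (affineBlowup I) ∧
      ∀ 𝔭 : PrimeSpectrum ↥(Algebra.adjoin K ({X ^ 2, X ^ 5} : Set K[X])), I ≤ 𝔭.asIdeal ↔
        ¬ IsRegularLocalRing (Localization.AtPrime 𝔭.asIdeal) := by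
  haveI := finiteType_cusp25 K
  exact Summit.ResolutionOfSingularities.ResolutionOfSingularities.Theorems.SectionAscent.OneShotCurves.stub_oneShotCurves
    p hp K _ (ringKrullDim_cusp25_lt_two K)

end PointBlowup

/-! ## The refuted strengthening, every prime -/

/-- **Refuted natural strengthening of the hypothesis `OneShot`, every prime `p`: "the blowing
up of an integral affine curve over a field of characteristic `p` at a singular closed point
(reduced centre) is regular" is FALSE** — witness `(ZMod p)[X², X⁵]` at its origin (whose
one-shot centres, which exist by `OneShot p 2`, are therefore non-reduced — e.g. the conductor
`(X⁴, X⁵, X⁶, X⁷)`). So the reduced singular locus — the one canonical, globally defined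
candidate centre — is not a one-shot centre in general; a gluing proof of `AffineToGlobal`
cannot use it. [folklore] -/
theorem not_reducedPoint_oneShotCentre (p : ℕ) (hp : p.Prime) :
    ¬ ∀ (K : Type) [Field K] [CharP K p] (A : Type) [CommRing A] [IsDomain A] [Algebra K A]
        [Algebra.FiniteType K A], ringKrullDim A < ((2 : ℕ) : WithBot ℕ∞) →
        ∀ 𝔭 : PrimeSpectrum A, 𝔭.asIdeal.IsMaximal →
          ¬ IsRegularLocalRing (Localization.AtPrime 𝔭.asIdeal) →
          Scheme.IsRegular (affineBlowup 𝔭.asIdeal) := by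
  intro h
  haveI : Fact p.Prime := ⟨hp⟩
  haveI := finiteType_cusp25 (ZMod p)
  obtain ⟨𝔭, hmax, hsing, hbl⟩ := exists_point_blowup_not_regular (ZMod p)
  exact hbl (h (ZMod p) _ (ringKrullDim_cusp25_lt_two (ZMod p)) 𝔭 hmax hsing)

end Summit.ResolutionOfSingularities.ResolutionOfSingularities.Theorems.AffineToGlobal.Negative

end
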